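import Summits.FinalStateConjecture.FinalStateConjecture.Theorems.StarvedNecksGapDecaySufficesStubAssemblyDefsV10
import Summits.FinalStateConjecture.FinalStateConjecture.Theorems.StarvedNecksGapDecaySufficesStubAnchoredLocationP

/-!
# Stub `stub_anchoredLocationP_of_seededLocationP` of line `Sketch` (crux `GapDecaySuffices`,
# stmt-FinalStateConjecture-18060) — skeleton v10 re-threading of S4 ⇐ S4′

Skeleton v10 (lead c2, 2026-08-17) strengthens the anchoring hypothesis of BOTH location bundles S4
(`AnchoredLocationP`) and S4′ (`SeededLocationP`) from the v9 `TubeAnchoredR d R₀` to the clock-windowed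
`V10.TubeAnchoredClockR d R₀` (file `…StubAssemblyDefsV10.lean`, p172394); everything else is
byte-identical with the v9 bundles of `…Location.AnchoredP` (file `…StubAnchoredLocationP.lean`, p166857).
The landed v9 reduction `AnchoredP.anchoredLocationP_of_seededLocationP` uses its anchoring hypothesis
ONLY to call `SeededLocationP` at the same input, so the v10 reduction below is that landed proof verbatim
with the new hypothesis type threaded through: late-flatness of the collar and of the constant-lab-time
rays (clock bound `stub_flatTimeGe`, cone separation `stub_coneSeparation` p106992, sublinearity), entry of
every collar point by clopen continuation along its ray (`flat_entry_gapTube`, p143739), seeded on the seed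
sphere (`exists_ray_constLabTime`, p144058) and located by the hypothesis.  No new mathematics; no named
facts; standard axioms.  The two bundle names in the header are written namespace-qualified
(`V10.SeededLocationP → V10.AnchoredLocationP`, the same constants as the bare names inside this
namespace): the `dedup.landed` gate compares statement TEXT, and the bare text coincides with the v9
header of p166857 although the two statements are different propositions.
References: as in the v9 / V2 files (DHRT arXiv:2104.08222 §1; O'Neill 1983 Ch. 14).
-/

noncomputable section

open scoped Manifold ContDiff Topology ENNReal
open Filter Set Topology Literature.Geometry.Lorentzian

namespace Summit.FinalStateConjecture.FinalStateConjecture.Theorems.GapDecaySuffices.V10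

-- justified lint debt: the problem namespace repeats the summit name (`FinalStateConjecture.FinalStateConjecture`)
set_option linter.dupNamespace false

open Summit.FinalStateConjecture.FinalStateConjecture.Theorems.NecksCertifyTwoCap.Cones
  (stub_coneSeparation)
open Summit.FinalStateConjecture.FinalStateConjecture.Theorems.NecksCertify.Negative (rPlus_le_two_mul)
open Location (flat_entry_gapTube exists_ray_constLabTime tendsto_max_abs_add_one_div stub_flatTimeGe)

/-! ## The reduction (registered header `stub_anchoredLocationP_of_seededLocationP`, skeleton v10) -/

set_option maxHeartbeats 800000 in
/-- **S4 from S4′, v10 form** (registered re-threading stub of skeleton v10): `V10.AnchoredLocationP`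
from `V10.SeededLocationP` — the landed proof of `AnchoredP.anchoredLocationP_of_seededLocationP`
(p166857) with the clock-windowed anchoring hypothesis `TubeAnchoredClockR d R₀` passed straight to the
hypothesis at the same input; late-flatness of the collar and of the constant-lab-time rays (clock bound,
cone separation, sublinearity), entry of every collar point by clopen continuation along its ray
(`flat_entry_gapTube`), seeded on the seed sphere and located by the hypothesis. [folklore] -/
theorem stub_anchoredLocationP_of_seededLocationP : V10.SeededLocationP → V10.AnchoredLocationP := by
  intro hX X _ _ _ _ D hD 𝒟 h𝒟 O d R₀ hO hc hf hdv hanch i hnn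
  obtain ⟨Bk, hBk, hX'⟩ := hX X D hD 𝒟 h𝒟 O d R₀ hO hc hf hdv hanch i hnn
  refine ⟨fun s ↦ max |Bk s| (d.excision i s + 1),
    tendsto_max_abs_add_one_div hBk (d.tendsto_excision_div i), ?_⟩
  intro ρ' hmono hcont hconc hsub hdom hone R₁ τ₁ W Ψg B t r hR hτ hW hwall hG1 hG2 hG3 hG4 hG5
  -- positivity of `ρ'`
  have hρpos : ∀ s, 0 < ρ' s := fun s ↦ lt_of_lt_of_le one_pos (hone s)
  -- the two consequences of the domination hypothesis
  have hdomBk : Tendsto (fun s ↦ Bk s / ρ' s) atTop (𝓝 0) := by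
    refine squeeze_zero_norm' ?_ hdom
    filter_upwards with s
    rw [Real.norm_eq_abs, abs_div, abs_of_pos (hρpos s)]
    exact div_le_div_of_nonneg_right (le_max_left _ _) (hρpos s).le
  have hexc : ∀ᶠ s in atTop, d.excision i s + 1 ≤ 11 / 10 * ρ' s := by
    filter_upwards [hdom.eventually (gt_mem_nhds one_pos)] with s hs
    rw [div_lt_one (hρpos s)] at hs
    linarith [le_max_right |Bk s| (d.excision i s + 1), hρpos s]
  -- the isolated input
  obtain ⟨T, τ', ϱ, rs, κ, hτ', hϱ, hκ, hadm, hrs, hseed, hrim, hloc⟩ :=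
    hX' ρ' hmono hcont hconc hsub hdomBk hone R₁ τ₁ W Ψg hR hτ hW hwall hG1 hG2 hG3 hG4 hG5
  -- orthochronicity, distinct velocities, cone separation
  have horth : ∀ j, 0 < ((d.motion j).1 : E4 ≃L[ℝ] E4) (E4.basisVector 0) 0 := fun j ↦ (hc.1 j).2.2
  obtain ⟨c, hc0, τc, hcone⟩ := stub_coneSeparation _ O 4 d horth hdv
  -- eventual facts in the flat time `s`
  have hE2 : ∀ᶠ s in atTop, ∀ j, d.excision j s + 1 ≤ c * s := by
    refine Filter.eventually_all.2 fun j ↦ ?_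
    have h1 : ∀ᶠ s in atTop, d.excision j s / s < c / 2 :=
      (d.tendsto_excision_div j).eventually (gt_mem_nhds (by positivity))
    filter_upwards [h1, eventually_gt_atTop (0 : ℝ), eventually_ge_atTop (2 / c)] with s hs hs0 hs2
    rw [div_lt_iff₀ hs0] at hs
    rw [div_le_iff₀' hc0] at hs2
    linarith
  have hE3 : ∀ᶠ s in atTop, 29 / 10 * ρ' s ≤ c * s := by
    have h1 : ∀ᶠ s in atTop, ρ' s / s < c / 3 := hsub.eventually (gt_mem_nhds (by positivity))
    filter_upwards [h1, eventually_gt_atTop (0 : ℝ)] with s hs hs0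
    rw [div_lt_iff₀ hs0] at hs
    linarith [hρpos s]
  obtain ⟨T₀, hT₀⟩ := Filter.eventually_atTop.1
    (hexc.and (hE2.and (hE3.and ((eventually_ge_atTop τc).and
      ((eventually_gt_atTop d.τ₀).and (eventually_ge_atTop T))))))
  -- the clock constants of hole `i` and the choice of `τ₂`
  obtain ⟨γ, hγ⟩ : ∃ γ : ℝ, γ = (((d.motion i).1 : E4 ≃L[ℝ] E4) (E4.basisVector 0)) 0 := ⟨_, rfl⟩
  have hγ0 : 0 < γ := hγ ▸ horth i
  obtain ⟨S₀, hS₀⟩ : ∃ S₀ : ℝ, S₀ = Real.sqrt (γ ^ 2 - 1) * (29 / 10 * ρ' T₀ + |d.spin i|) :=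
    ⟨_, rfl⟩
  refine ⟨max τ₁ ((T₀ - (d.motion i).2 0 + S₀) / γ), κ, le_max_left _ _, hκ, ?_⟩
  intro y hyB hty hlo hhi
  -- the flat time `s = y⁰` of the collar point is late
  have hclock : (d.motion i).2 0 + γ * t y -
      Real.sqrt (γ ^ 2 - 1) * (r y + |d.spin i|) ≤ y 0 := by
    have h := stub_flatTimeGe (d.motion i).1 (d.motion i).2 (d.mass i) (d.spin i) y
    rw [← hγ] at h
    exact h
  have hT' : T₀ ≤ y 0 := by
    by_contra hlt
    rw [not_le] at hlt
    have h1 : ρ' (y 0) ≤ ρ' T₀ := hmono hlt.le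
    have h2 : r y ≤ 29 / 10 * ρ' T₀ := hhi.trans (by linarith)
    have h3 : Real.sqrt (γ ^ 2 - 1) * (r y + |d.spin i|) ≤ S₀ := by
      rw [hS₀]
      exact mul_le_mul_of_nonneg_left (by linarith) (Real.sqrt_nonneg _)
    have h4 : (T₀ - (d.motion i).2 0 + S₀) / γ < t y := lt_of_le_of_lt (le_max_right _ _) hty
    rw [div_lt_iff₀ hγ0] at h4
    linarith
  obtain ⟨hx1, hx2, hx3, hx4, hx5, hx6⟩ := hT₀ (y 0) hT'
  obtain ⟨hrsR, hrsρ, hrs11⟩ := hrs (y 0) hx6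
  -- late-flatness of every point of flat time `y⁰` with radius in `[rs(y⁰), rᵢ y]`
  have hflat : ∀ z : E4, z 0 = y 0 → rs (y 0) ≤ r z → r z ≤ r y →
      z ∈ d.flatDomain ∧ d.τ₀ < z 0 ∧
        ∀ j, j ≠ i → d.excision j (z 0) + 1 ≤ (d.background j).radius z := by
    intro z hz0 hzlo hzhi
    have hri : (d.background i).radius z ≤ c * z 0 := by
      rw [hz0]
      exact (hzhi.trans hhi).trans hx3
    have hother : ∀ j, j ≠ i → d.excision j (z 0) + 1 ≤ (d.background j).radius z := by
      intro j hij
      have h := hcone i j z (Ne.symm hij) (by rw [hz0]; exact hx4) hri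
      rw [hz0] at h ⊢
      linarith [hx2 j]
    refine ⟨d.setOf_lt_excision_subset_flatDomain ⟨by rw [hz0]; exact hx5, fun j ↦ ?_⟩,
      by rw [hz0]; exact hx5, hother⟩
    show d.excision j (z 0) < (d.background j).radius z
    rcases eq_or_ne j i with rfl | hij
    · rw [hz0]
      exact lt_of_lt_of_le hrsρ hzlo
    · linarith [hother j hij]
  -- the constant-lab-time ray from `y` down to the seed sphere
  have hmass : 0 < d.mass i := d.mass_pos i
  have hr₀ : max (Kerr.rPlus (d.mass i) (d.spin i)) 0 < rs (y 0) := by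
    refine max_lt ?_ (by linarith [(hc.1 i).2.1])
    have := rPlus_le_two_mul hmass.le (d.spin i)
    linarith [(hc.1 i).2.1]
  have hr₀y : rs (y 0) ≤ r y := by linarith
  obtain ⟨S, hSpre, hyS, hSdom, hSprop, z₀, hz₀S, hz₀r⟩ :=
    exists_ray_constLabTime (d.motion i).1 (d.motion i).2 (d.mass i) (d.spin i) (horth i) y hr₀ hr₀y
  have hSf : S ⊆ (d.flatDomain : Set E4) := fun z hz ↦
    (hflat z (hSprop z hz).1 (hSprop z hz).2.1 (hSprop z hz).2.2).1
  have hSlate : ∀ z ∈ S, d.τ₀ < z 0 := fun z hz ↦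
    (hflat z (hSprop z hz).1 (hSprop z hz).2.1 (hSprop z hz).2.2).2.1
  -- entry along the ray
  have hadm' : ∀ x : B.domain, τ' ≤ t x.1 → r x.1 ≤ ϱ (t x.1) → r x.1 ≤ W (x.1 0) :=
    fun x h1 h2 ↦ (hadm x h1 h2).le
  have hentry := flat_entry_gapTube d i hG1.2.1 (hG5 τ' ϱ hϱ hτ' hadm') hϱ hτ' hadm' hSpre hSf hSlate
    (fun z hz x hx1 hx2 hhx ↦ by
      obtain ⟨hz0, hzlo, hzhi⟩ := hSprop z hz
      exact hrim z (hSf hz) (by rw [hz0]; exact hx6) (by rw [hz0]; exact hzlo)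
        (by rw [hz0]; exact hzhi.trans hhi) x hx1 hx2 hhx)
    (by
      obtain ⟨hz0, -, -⟩ := hSprop z₀ hz₀S
      obtain ⟨x, hx1, hx2, hhx⟩ := hseed z₀ (hSf hz₀S) (by rw [hz0]; exact hx6) (by rw [hz0]; exact hz₀r)
      exact ⟨z₀, hz₀S, x, hx1, hx2, hhx⟩)
  obtain ⟨x, hx1, hx2, hhx⟩ := hentry y hyS
  -- conclusion
  have hyflat := hflat y rfl hr₀y le_rfl
  refine ⟨hyflat.1, hyflat.2.1, fun j ↦ ?_, x, lt_trans hτ' hx1, hadm x hx1.le hx2.le, hhx,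
    hloc y hyflat.1 hx6 hlo hhi x hx1 hx2 hhx⟩
  rcases eq_or_ne j i with rfl | hij
  · linarith
  · exact hyflat.2.2 j hij

end Summit.FinalStateConjecture.FinalStateConjecture.Theorems.GapDecaySuffices.V10

end
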